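import Summits.ValiantsHypothesis.ValiantsHypothesis.Theorems.LacunarySymmetroidMatrixDescartesIndexOneInflection

/-!
# `MatrixDescartes` (stmt-ValiantsHypothesis-18050) — pivot column at index one: AT EVERY POSITIVE ROOT THE PENCIL IS PSD,
# so every root lies OUTSIDE the Rayleigh window of every other root («node-free windows»)

HONEST FRAMING.  Cell `pub-symmetroid`, seat `val-sym-mdr-p2` (gen 23); helper file `--supports` the crux
`Theses.LacunarySymmetroid.MatrixDescartes` (OPEN), NO closure claim.  A qualitative structure theorem for conjb-1's index-one
pivot column (`…CensusPivotDefs`), companion of `…IndexOneInflection` (this seat): the input the chain / kernel-node method of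
`…VLawCore`, `…FanLaw` (nodes `F(xᵢ)vᵢ = 0`, Rayleigh K-nomials `Rᵢ(x) = vᵢᵀF(x)vᵢ`) needs at index one.  Nothing here bears on
`MatrixDescartes` in its window, on `stub_twoSided`, on `DoorA26` / `DoorA34`, the census registers, or `VP ≠ VNP`.

CONTENT.
* `posSemidef_sub_smul_vecMulVec_of_det_eq_zero` (linear algebra): `D ≻ 0` real symmetric, `c` real, `det(D − c·w wᵀ) = 0`
  ⇒ `D − c·w wᵀ ⪰ 0`.  Proof without eigenvalues: a kernel vector `u` has `D u = c (wᵀu) w`, and for every `v`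
  `q·(vᵀ(D − c w wᵀ)v) = (q v − (uᵀDv) u)ᵀ D (q v − (uᵀDv) u) ≥ 0` with `q = uᵀDu > 0` (Cauchy–Schwarz in the `D`-inner product,
  written as one square).
* `pivot_posSemidef_at_root`: for the index-one pivot pencil `F = X^e (A − w wᵀ) + ∑ X^{dₖ} Pₖ` with PSD letters `A, Pₖ` and
  `A + ∑ Pₖ ≻ 0`, at every positive root `x₀` of `det F` the real matrix `F(x₀)` is POSITIVE SEMIDEFINITE (the vanishing eigenvalue is
  the bottom one; between roots `F(x)` is either `≻ 0` or has exactly one negative eigenvalue).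
* `rayleigh_nonneg_at_root` (NODE-FREE WINDOWS): consequently `vᵀF(x₀)v ≥ 0` for EVERY vector `v` — in particular for the kernel
  vector `v₁` of any other root `x₁`, whose Rayleigh K-nomial `R₁(x) = v₁ᵀF(x)v₁` (convex in `log x`, `R₁(x₁) = 0`) is therefore
  `≥ 0` at `x₀`: no positive root of `det F` lies in the open negativity window of another root's Rayleigh K-nomial.

[folklore] Elementary linear algebra over Mathlib (`Matrix.exists_mulVec_eq_zero_iff`, `Matrix.PosDef` API); the pencil bookkeeping
reuses `SecularRolle.skeleton_posDef` of `…IndexOneInflection`.  Axioms `propext`, `Classical.choice`, `Quot.sound`.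
-/

set_option linter.dupNamespace false

namespace Summit.ValiantsHypothesis.ValiantsHypothesis.Theorems.LacunarySymmetroidMatrixDescartes.SecularRolle

open Polynomial Matrix Finset
open scoped BigOperators

variable {m K : ℕ}

/-! ### §1. Linear algebra: a singular rank-one update of a positive definite matrix is PSD -/

/-- `(w wᵀ) v = (wᵀv) w`. [folklore] -/
theorem vecMulVec_mulVec_eq (w v : Fin m → ℝ) : vecMulVec w w *ᵥ v = (w ⬝ᵥ v) • w := by
  ext i
  simp [Matrix.mulVec, vecMulVec_apply, dotProduct, Finset.mul_sum, mul_comm, mul_left_comm]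

/-- symmetry of the `D`-form for a real Hermitian (= symmetric) matrix. [folklore] -/
theorem dotProduct_mulVec_comm {D : Matrix (Fin m) (Fin m) ℝ} (hD : D.IsHermitian) (u v : Fin m → ℝ) :
    u ⬝ᵥ (D *ᵥ v) = v ⬝ᵥ (D *ᵥ u) := by
  have h : Dᵀ = D := by
    have := hD
    unfold Matrix.IsHermitian at this
    simpa using this
  calc u ⬝ᵥ (D *ᵥ v) = (u ᵥ* D) ⬝ᵥ v := (dotProduct_mulVec u D v)
    _ = (Dᵀ *ᵥ u) ⬝ᵥ v := by rw [Matrix.mulVec_transpose]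
    _ = v ⬝ᵥ (D *ᵥ u) := by rw [h, dotProduct_comm]

/-- **A singular nonnegative rank-one downdate of a positive definite matrix is positive semidefinite.**
`D ≻ 0`, `det (D − c·w wᵀ) = 0` ⇒ `D − c·w wᵀ ⪰ 0` (any real `c`; for `c < 0` the hypothesis is void). [folklore] -/
theorem posSemidef_sub_smul_vecMulVec_of_det_eq_zero {D : Matrix (Fin m) (Fin m) ℝ} (hD : D.PosDef)
    (c : ℝ) (w : Fin m → ℝ) (hdet : (D - c • vecMulVec w w).det = 0) :
    (D - c • vecMulVec w w).PosSemidef := by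
  obtain ⟨u, hu, hFu⟩ := Matrix.exists_mulVec_eq_zero_iff.mpr hdet
  -- `D u = c (w·u) w`
  have hDu : D *ᵥ u = (c * (w ⬝ᵥ u)) • w := by
    have h : (D - c • vecMulVec w w) *ᵥ u = D *ᵥ u - (c * (w ⬝ᵥ u)) • w := by
      rw [Matrix.sub_mulVec, Matrix.smul_mulVec, vecMulVec_mulVec_eq, smul_smul]
    rw [h] at hFu
    exact sub_eq_zero.mp hFu
  obtain ⟨q, hq⟩ : ∃ q : ℝ, q = u ⬝ᵥ (D *ᵥ u) := ⟨_, rfl⟩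
  have hqpos : 0 < q := by rw [hq]; simpa using hD.dotProduct_mulVec_pos hu
  have hsymm := dotProduct_mulVec_comm hD.1
  -- Hermitian part
  have hH : (D - c • vecMulVec w w).IsHermitian := by
    have h2 : (c • vecMulVec w w : Matrix (Fin m) (Fin m) ℝ).IsHermitian := by
      unfold Matrix.IsHermitian
      ext i j
      simp [vecMulVec_apply, mul_comm]
    exact hD.1.sub h2
  refine PosSemidef.of_dotProduct_mulVec_nonneg hH fun v => ?_
  obtain ⟨b, hb⟩ : ∃ b : ℝ, b = u ⬝ᵥ (D *ᵥ v) := ⟨_, rfl⟩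
  have hb' : b = c * (w ⬝ᵥ u) * (w ⬝ᵥ v) := by
    rw [hb, hsymm u v, hDu, dotProduct_smul, smul_eq_mul, dotProduct_comm v w]
  have hq' : q = c * (w ⬝ᵥ u) * (w ⬝ᵥ u) := by
    rw [hq, hDu, dotProduct_smul, smul_eq_mul, dotProduct_comm u w]
  have hbq : b * b = c * q * ((w ⬝ᵥ v) * (w ⬝ᵥ v)) := by rw [hb', hq']; ring
  -- one square: (q v − b u)ᵀ D (q v − b u) = q (q vᵀDv − b²) = q² (vᵀDv − c (w·v)²)
  have hsq : 0 ≤ (q • v - b • u) ⬝ᵥ (D *ᵥ (q • v - b • u)) := by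
    simpa using hD.posSemidef.dotProduct_mulVec_nonneg (q • v - b • u)
  have hexp : (q • v - b • u) ⬝ᵥ (D *ᵥ (q • v - b • u))
      = q * q * (v ⬝ᵥ (D *ᵥ v)) - q * b * (v ⬝ᵥ (D *ᵥ u)) - b * q * (u ⬝ᵥ (D *ᵥ v))
        + b * b * (u ⬝ᵥ (D *ᵥ u)) := by
    rw [Matrix.mulVec_sub, Matrix.mulVec_smul, Matrix.mulVec_smul, dotProduct_sub, sub_dotProduct, sub_dotProduct,
      dotProduct_smul, dotProduct_smul, dotProduct_smul, dotProduct_smul, smul_dotProduct, smul_dotProduct,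
      smul_dotProduct, smul_dotProduct]
    simp only [smul_eq_mul]
    ring
  have hval : (q • v - b • u) ⬝ᵥ (D *ᵥ (q • v - b • u))
      = q * q * (v ⬝ᵥ (D *ᵥ v) - c * ((w ⬝ᵥ v) * (w ⬝ᵥ v))) := by
    rw [hexp, hsymm v u, ← hb, ← hq]
    have : q * q * (v ⬝ᵥ (D *ᵥ v)) - q * b * b - b * q * b + b * b * q = q * (q * (v ⬝ᵥ (D *ᵥ v)) - b * b) := by
      ring
    rw [this, hbq]
    ring
  have hform : star v ⬝ᵥ ((D - c • vecMulVec w w) *ᵥ v) = v ⬝ᵥ (D *ᵥ v) - c * ((w ⬝ᵥ v) * (w ⬝ᵥ v)) := by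
    rw [star_trivial, Matrix.sub_mulVec, Matrix.smul_mulVec, vecMulVec_mulVec_eq, dotProduct_sub, smul_smul,
      dotProduct_smul, smul_eq_mul, dotProduct_comm v w]
    ring
  rw [hform]
  by_contra hneg
  have hlt : v ⬝ᵥ (D *ᵥ v) - c * ((w ⬝ᵥ v) * (w ⬝ᵥ v)) < 0 := lt_of_not_ge hneg
  have h1 : q * q * (v ⬝ᵥ (D *ᵥ v) - c * ((w ⬝ᵥ v) * (w ⬝ᵥ v))) < 0 := mul_neg_of_pos_of_neg (mul_pos hqpos hqpos) hlt
  rw [← hval] at h1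
  exact absurd hsq (not_le.mpr h1)

/-! ### §2. Index-one pivot pencils: PSD at every positive root, node-free windows -/

/-- Evaluating the pivot pencil `X^e J + ∑ X^{dₖ} Pₖ` at a real point. [folklore] -/
theorem pivot_map_eval (e : ℕ) (d : Fin K → ℕ) (J : Matrix (Fin m) (Fin m) ℝ)
    (P : Fin K → Matrix (Fin m) (Fin m) ℝ) (x : ℝ) :
    (((X : ℝ[X]) ^ e) • J.map Polynomial.C + ∑ k, ((X : ℝ[X]) ^ d k) • (P k).map Polynomial.C).map (Polynomial.eval x)
      = x ^ e • J + ∑ k, x ^ d k • P k := by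
  ext i j
  simp only [Matrix.map_apply, Matrix.add_apply, Matrix.smul_apply, Matrix.sum_apply, smul_eq_mul,
    Polynomial.eval_add, Polynomial.eval_finsetSum, Polynomial.eval_mul, Polynomial.eval_pow, Polynomial.eval_X,
    Polynomial.eval_C]

/-- `(det F)(x) = det F(x)` for the pivot pencil. [folklore] -/
theorem det_pivot_eval (e : ℕ) (d : Fin K → ℕ) (J : Matrix (Fin m) (Fin m) ℝ)
    (P : Fin K → Matrix (Fin m) (Fin m) ℝ) (x : ℝ) :
    (Matrix.det (((X : ℝ[X]) ^ e) • J.map Polynomial.C + ∑ k, ((X : ℝ[X]) ^ d k) • (P k).map Polynomial.C)).eval x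
      = Matrix.det (x ^ e • J + ∑ k, x ^ d k • P k) := by
  rw [← pivot_map_eval e d J P x, ← Polynomial.coe_evalRingHom, RingHom.map_det, RingHom.mapMatrix_apply]

/-- **AT EVERY POSITIVE ROOT AN INDEX-ONE PIVOT PENCIL IS PSD.**  Pivot pencil `F = X^e J + ∑ X^{dₖ} Pₖ` with `Pₖ ⪰ 0` and a
pivot of index `≤ 1` written as `J + w wᵀ ⪰ 0` (for `PivotRootLawAt … 1 …` take `w = W · 0`, `SecularRolle.mul_transpose_width_one`),
non-degenerate skeleton `(J + w wᵀ) + ∑ Pₖ ≻ 0`: if `x > 0` and `det F(x) = 0` then `F(x) ⪰ 0` — the vanishing eigenvalue is the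
smallest one. [folklore] -/
theorem pivot_posSemidef_at_root (e : ℕ) (d : Fin K → ℕ) {J : Matrix (Fin m) (Fin m) ℝ} {w : Fin m → ℝ}
    {P : Fin K → Matrix (Fin m) (Fin m) ℝ} (hJ : (J + vecMulVec w w).PosSemidef) (hP : ∀ k, (P k).PosSemidef)
    (hpd : (J + vecMulVec w w + ∑ k, P k).PosDef) {x : ℝ} (hx : 0 < x)
    (hroot : (Matrix.det (((X : ℝ[X]) ^ e) • J.map Polynomial.C
        + ∑ k, ((X : ℝ[X]) ^ d k) • (P k).map Polynomial.C)).eval x = 0) :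
    (x ^ e • J + ∑ k, x ^ d k • P k).PosSemidef := by
  have hmat : x ^ e • J + ∑ k, x ^ d k • P k
      = (x ^ e • (J + vecMulVec w w) + ∑ k, x ^ d k • P k) - x ^ e • vecMulVec w w := by
    rw [smul_add]; abel
  have hD := skeleton_posDef e d hJ hP hpd hx
  rw [det_pivot_eval, hmat] at hroot
  rw [hmat]
  exact posSemidef_sub_smul_vecMulVec_of_det_eq_zero hD (x ^ e) w hroot

/-- **NODE-FREE WINDOWS.**  Under the same hypotheses, at a positive root `x` of `det F`: `vᵀ F(x) v ≥ 0` for EVERY `v`.  In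
particular, if `x₁` is another positive root with kernel vector `v₁` (`F(x₁) v₁ = 0`), its Rayleigh K-nomial `R₁(y) = v₁ᵀ F(y) v₁`
(`R₁(x₁) = 0`, convex in `log y`) satisfies `R₁(x) ≥ 0`: NO positive root of `det F` lies in the open negativity window of another
root's Rayleigh K-nomial (the starting point of the kernel-node / chain method of `…VLawCore`, `…FanLaw` at index one). [folklore] -/
theorem rayleigh_nonneg_at_root (e : ℕ) (d : Fin K → ℕ) {J : Matrix (Fin m) (Fin m) ℝ} {w : Fin m → ℝ}
    {P : Fin K → Matrix (Fin m) (Fin m) ℝ} (hJ : (J + vecMulVec w w).PosSemidef) (hP : ∀ k, (P k).PosSemidef)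
    (hpd : (J + vecMulVec w w + ∑ k, P k).PosDef) {x : ℝ} (hx : 0 < x)
    (hroot : (Matrix.det (((X : ℝ[X]) ^ e) • J.map Polynomial.C
        + ∑ k, ((X : ℝ[X]) ^ d k) • (P k).map Polynomial.C)).eval x = 0)
    (v : Fin m → ℝ) :
    0 ≤ v ⬝ᵥ ((x ^ e • J + ∑ k, x ^ d k • P k) *ᵥ v) := by
  simpa using (pivot_posSemidef_at_root e d hJ hP hpd hx hroot).dotProduct_mulVec_nonneg v

/-- The same in `roots` language: for `x ∈ (det F).roots` with `0 < x`, `F(x) ⪰ 0`. [folklore] -/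
theorem pivot_posSemidef_of_mem_roots (e : ℕ) (d : Fin K → ℕ) {J : Matrix (Fin m) (Fin m) ℝ} {w : Fin m → ℝ}
    {P : Fin K → Matrix (Fin m) (Fin m) ℝ} (hJ : (J + vecMulVec w w).PosSemidef) (hP : ∀ k, (P k).PosSemidef)
    (hpd : (J + vecMulVec w w + ∑ k, P k).PosDef) {x : ℝ} (hx : 0 < x)
    (hmem : x ∈ (Matrix.det (((X : ℝ[X]) ^ e) • J.map Polynomial.C
        + ∑ k, ((X : ℝ[X]) ^ d k) • (P k).map Polynomial.C)).roots) :
    (x ^ e • J + ∑ k, x ^ d k • P k).PosSemidef :=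
  pivot_posSemidef_at_root e d hJ hP hpd hx ((Polynomial.mem_roots'.mp hmem).2)

end Summit.ValiantsHypothesis.ValiantsHypothesis.Theorems.LacunarySymmetroidMatrixDescartes.SecularRolle
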